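import Summits.QuantumFields.YangMills.Theorems.UnitScaleTiltProp7PinnedSliceRowMember
import Summits.QuantumFields.YangMills.Theorems.UnitScaleTiltProp7LinearCorrectorCloseMember
import HarnessLib

/-!
# Route `UnitScaleTilt`, crux K1 «MinimiserStabilityRegPr» (stmt-QuantumFields-19200), route-R E′ path (α′), (E1) «pinned slice theorem»: THE (E1) CONJUNCT AT THE MEMBERS OF RECORD
# WITH BOTH SOCKETS OF THE DOOR DISCHARGED — ✓ `Prop7PinnedSliceRowMember.pinnedSliceRow_member_of_thm2Datum` (w1 g13) ∘ ✓ `Prop7DatumOfThm2S.hDatum_of_thm2S_member` (px13 g4: the Thm-2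
# datum from the EX knit's [B8]-Theorem-2 binder `hThm2S`) ∘ ✓ `Prop7LinearCorrectorCloseMember.linCorr_member` (★routeR-w3 g6: the (E1-b) L-row from px22's (A-cov) member theorem),
# the member window row made k-UNIFORM (an L-only numeric inequality implies it at every level)

Cell `ym3-torus`, width seat `ym-ust-19200-w1` (gen 13); row «HDATUM E2E AT THE MEMBER» §3 (★p1 g17 WORD 4 (a)).  THEOREMS ONLY (0 `def`, 0 `sorry`, 0 `instance`); `--supports
stmt-QuantumFields-19200`, count-neutral.  YM₃ on T³ is a ladder rung (R3) — not d = 4, not infinite volume, not a mass gap, not the Clay problem; nothing here claims a stub, the crux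
or (E1) in the E′ display's generality: members of record only (`4 ≤ ℓ`, `a′ + 3 ≤ F.m + n`, `8 ≤ L^{a′}`), [B8] Theorem 2 enters as the interface `Thm2SetupSUAt` (a hypothesis SHAPE,
`hThm2S`), and every numeric window is displayed (L-only).

WHY.  After ✓p687026 the E1 side of the E′ display at members of record is `hThm2S ∧ hLrowM ∧ windows`; ✓p687003 `linCorr_member` inhabits `hLrowM`'s body at every `RegPr` member
of record behind px4's standing data and ONE member-dependent numeric row — the window `BIG·2²·ℓ_k⁴·(d²·(8(α₀ℓ_k⁻²)² + (2ℓ_k⁻²Xe^{X∕ℓ_k} + 4(ℓ_k⁻¹Xe^{X∕ℓ_k})²)²)) ≤ 1∕4`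
(`ℓ_k = L^{K−n}`, `X = c35·(L·L^{a′})·α₀`).  §1 proves that this row is k-UNIFORMLY implied by the L-only inequality `BIG·2²·(3²·(8α_M² + (2X_Me^{X_M} + 4(X_Me^{X_M})²)²)) ≤ 1∕4` whenever
`α₀ ≤ α_M`, `X ≤ X_M` (`ℓ_k ≥ 1`: `ℓ_k⁴·u⁴ = 1`, `u = ℓ_k⁻¹ ≤ 1`, `e^{uX} ≤ e^X`, `2u + 4 ≤ 6`); §2 composes: the (E1) conjunct at the members of record from `hThm2S` ALONE plus
L-only windows and the regime `(L·L^{a′})·e ≤ min a₅ a_L`.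

WHAT IS PROVED (ns `…Theorems.Prop7PinnedSliceRowMemberClosed`).
* §1 `window_core` (pure real algebra: the k-uniform domination), `window_mono` (monotonicity of the L-only bound in `(α, X)`), ★★ `hwin_member_of_window` — the member window row of
  ✓p681077∕✓p684681∕✓p686350∕✓p687003 (VERBATIM) at level `K − n` from `α₀ ≤ α_M`, `c35·(L·L^{a′})·α₀ ≤ X_M` and the L-only inequality at `(α_M, X_M)`.
* §2 ★★★ `pinnedSliceRow_member_of_thm2S_linCorr (hℓ4 : 4 ≤ ℓ) (hL) (hB₁ hc₁) (hThm2S)` : `∃ B₁' c₁' c35 a₅ c35L aL c C₂ > 0` (L-only: P3's four, `linCorr_member`'s four) such that for all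
  `e₆ s sQ` with `0 < e₆ ≤ 1`, `2e₆ ≤ c₁'`, P3's five numeric windows at `e₆`, the door's eight windows at `s₀ := 2B₁'e₆, s₁′ := 6B₁'e₆, σ := 240B₁'e₆, c₀ = c₁ := c35·a₅·e^{c35·a₅}`,
  `C := max (3∕2·(c√2)) (max (c√2) C₂)`, the L-only member window at `(α_M, X_M) := (e₆, c35L·aL)`, and `sQ = 2s + 9Cs`: **for every member `F` (`F.L = ℓ+1`), `n < K`, `a′` with
  `a′ + 3 ≤ F.m + n`, `8 ≤ (ℓ+1)^{a′}`, every `0 < e ≤ e₆` with `((ℓ+1)·(ℓ+1)^{a′})·e ≤ min a₅ aL`, every critical `W ∈ (6)(e) ∩ 𝔅_k(V)` and competitor `W′ ∈ (6)(e) ∩ 𝔅_k(V)`: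
  `∃ Y ∈ (6)(e) ∩ 𝔅_k(V)`, `A(W′) = A(Y)`, `‖↑(Y_bW_b⁻¹) − 1‖ ≤ sQ·ℓ_k⁻¹`, `S_H` off the centres.**  The only non-numeric hypothesis is `hThm2S`.
HONEST SCOPE.  Composition + one elementary real inequality; every analytic input is a landed theorem of the seats named (px13 g4, ★routeR-w3 g6, px22 g3, px11 g4, routeR-w6 g7,
routeR-w4, px4, w1 g12); [B8] Thm 2 is NOT proved; small members (outside the record data) are not covered; (E1)∕E′∕EX∕the crux are NOT claimed.

References: T. Bałaban, CMP **102** (1985) 277–309 [Balaban1985Variational] (Prop. 7 p.299, (141)–(143) p.299, (19) and Prop. 2 p.281); CMP **99** (1985) 75–102 [Balaban1985RegularSpaces]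
(Thm 2 p.83, (1.36) p.82, (1.72) p.88); CMP **99** (1985) 389–434 [Balaban1985BackgroundPropagators] ((3.8) p.392, (3.35) p.396).
-/

set_option autoImplicit false

noncomputable section

open scoped BigOperators Matrix.Norms.L2Operator Matrix
open NormedSpace

namespace Summit.QuantumFields.YangMills.Theorems.Prop7PinnedSliceRowMemberClosed

open Literature.MathematicalPhysics.QuantumFieldTheory.Balaban1983to89
open Literature.MathematicalPhysics.QuantumFieldTheory.Balaban1983to89.T3ContinuumYM3Torus
open Literature.MathematicalPhysics.QuantumFieldTheory.Balaban1983to89.T3PrintedRegularMinimiser (RegPr regFibrePr mem_regFibrePr_iff)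
open Literature.MathematicalPhysics.QuantumFieldTheory.Balaban1983to89.T3SectALandauChart (emb15 eta)
open Literature.MathematicalPhysics.QuantumFieldTheory.Balaban1983to89.T3Thm1CarrierNative (IsCritR2)
open Literature.MathematicalPhysics.QuantumFieldTheory.Balaban1983to89.B6GlobalChartV1 (PV)
open T4Continuum
open MatrixLog (mlog)
open B7Prop1Explicit renaming Site → LSite
open B7Prop2Explicit (C0 c2')
open B7Prop3Flat (c3)
open B8Thm2SetupTorus (Thm2SetupSUAt)
open B9Eq39Adjoint (covD divB)
open B9TorusCalculus (torusT)
open B15DeterminingSets (embIter)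
open B10Eq27TorusAxialLog (unitsField toUField)
open B5Eq118OneStroke (iterBlockOf)
open Summit.QuantumFields.YangMills.Theorems.Prop7TPrint (expHermField)
open Summit.QuantumFields.YangMills.Theorems.Prop7SectET3Members (hd3)
open Summit.QuantumFields.YangMills.Theorems.Prop7PinnedSliceRowMember (pinnedSliceRow_member_of_thm2Datum)
open Summit.QuantumFields.YangMills.Theorems.Prop7DatumOfThm2S (hDatum_of_thm2S_member)
open Summit.QuantumFields.YangMills.Theorems.Prop7LinearCorrectorCloseMember (linCorr_member)

/-! ## §1 The member window row is implied, uniformly in the level, by an L-only inequality -/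

/-- Pure real algebra: for `ℓ_k ≥ 1`, `X ≥ 0`, with `u = ℓ_k⁻¹`:
`B·ℓ_k⁴·(3²·(8(α₀u²)² + (2u(uX)e^{uX} + 4((uX)e^{uX})²)²)) ≤ B·(3²·(8α₀² + (2Xe^X + 4(Xe^X)²)²))` (`ℓ_k⁴u⁴ = 1`, `u ≤ 1`, `e^{uX} ≤ e^X`). [folklore] -/
theorem window_core {B ℓk α₀ X : ℝ} (hB : 0 ≤ B) (hℓk : 1 ≤ ℓk) (hX : 0 ≤ X) :
    B * ℓk ^ 4 * ((3 : ℝ) ^ 2 * (4 * ((2 : ℕ) : ℝ) * (α₀ * (ℓk⁻¹) ^ 2) ^ 2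
        + (2 * (ℓk⁻¹ * (ℓk⁻¹ * X) * Real.exp (ℓk⁻¹ * X)) + 4 * (ℓk⁻¹ * X * Real.exp (ℓk⁻¹ * X)) ^ 2) ^ 2))
      ≤ B * ((3 : ℝ) ^ 2 * (4 * ((2 : ℕ) : ℝ) * α₀ ^ 2 + (2 * X * Real.exp X + 4 * (X * Real.exp X) ^ 2) ^ 2)) := by
  have hℓk0 : 0 < ℓk := lt_of_lt_of_le one_pos hℓk
  have hu0 : 0 < ℓk⁻¹ := inv_pos.mpr hℓk0
  have hu1 : ℓk⁻¹ ≤ 1 := inv_le_one_of_one_le₀ hℓk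
  set u : ℝ := ℓk⁻¹ with hu
  have huX : u * X ≤ X := by nlinarith
  have hexp : Real.exp (u * X) ≤ Real.exp X := Real.exp_le_exp.mpr huX
  have hexp0 : 0 < Real.exp (u * X) := Real.exp_pos _
  set E := Real.exp X with hE
  set Eu := Real.exp (u * X) with hEu
  -- the `c35`-summand is `u²·(2XEu + 4(XEu)²)`, dominated by `u²·(2XE + 4(XE)²)`
  have hXEu : X * Eu ≤ X * E := mul_le_mul_of_nonneg_left hexp hX
  have hXEu0 : 0 ≤ X * Eu := by positivity
  have hsq1 : (X * Eu) ^ 2 ≤ (X * E) ^ 2 := pow_le_pow_left₀ hXEu0 hXEu 2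
  have hT : 2 * (u * (u * X) * Eu) + 4 * (u * X * Eu) ^ 2 ≤ u ^ 2 * (2 * X * E + 4 * (X * E) ^ 2) := by
    have hrw : 2 * (u * (u * X) * Eu) + 4 * (u * X * Eu) ^ 2 = u ^ 2 * (2 * (X * Eu) + 4 * (X * Eu) ^ 2) := by ring
    rw [hrw]
    exact mul_le_mul_of_nonneg_left (by nlinarith) (by positivity)
  have hT0 : 0 ≤ 2 * (u * (u * X) * Eu) + 4 * (u * X * Eu) ^ 2 := by positivity
  have hT2 : (2 * (u * (u * X) * Eu) + 4 * (u * X * Eu) ^ 2) ^ 2 ≤ u ^ 4 * (2 * X * E + 4 * (X * E) ^ 2) ^ 2 := by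
    calc (2 * (u * (u * X) * Eu) + 4 * (u * X * Eu) ^ 2) ^ 2 ≤ (u ^ 2 * (2 * X * E + 4 * (X * E) ^ 2)) ^ 2 := pow_le_pow_left₀ hT0 hT 2
      _ = u ^ 4 * (2 * X * E + 4 * (X * E) ^ 2) ^ 2 := by ring
  have hS : 4 * ((2 : ℕ) : ℝ) * (α₀ * u ^ 2) ^ 2 = u ^ 4 * (4 * ((2 : ℕ) : ℝ) * α₀ ^ 2) := by ring
  have hsum : 4 * ((2 : ℕ) : ℝ) * (α₀ * u ^ 2) ^ 2 + (2 * (u * (u * X) * Eu) + 4 * (u * X * Eu) ^ 2) ^ 2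
      ≤ u ^ 4 * (4 * ((2 : ℕ) : ℝ) * α₀ ^ 2 + (2 * X * E + 4 * (X * E) ^ 2) ^ 2) := by rw [hS]; nlinarith
  have hℓu : ℓk ^ 4 * u ^ 4 = 1 := by rw [hu, ← mul_pow, mul_inv_cancel₀ hℓk0.ne', one_pow]
  have hBℓ : 0 ≤ B * ℓk ^ 4 := by positivity
  calc B * ℓk ^ 4 * ((3 : ℝ) ^ 2 * (4 * ((2 : ℕ) : ℝ) * (α₀ * u ^ 2) ^ 2 + (2 * (u * (u * X) * Eu) + 4 * (u * X * Eu) ^ 2) ^ 2))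
      ≤ B * ℓk ^ 4 * ((3 : ℝ) ^ 2 * (u ^ 4 * (4 * ((2 : ℕ) : ℝ) * α₀ ^ 2 + (2 * X * E + 4 * (X * E) ^ 2) ^ 2))) :=
        mul_le_mul_of_nonneg_left (mul_le_mul_of_nonneg_left hsum (by positivity)) hBℓ
    _ = B * (ℓk ^ 4 * u ^ 4) * ((3 : ℝ) ^ 2 * (4 * ((2 : ℕ) : ℝ) * α₀ ^ 2 + (2 * X * E + 4 * (X * E) ^ 2) ^ 2)) := by ring
    _ = B * ((3 : ℝ) ^ 2 * (4 * ((2 : ℕ) : ℝ) * α₀ ^ 2 + (2 * X * E + 4 * (X * E) ^ 2) ^ 2)) := by rw [hℓu, mul_one]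

/-- The L-only bound is monotone in `(α₀, X)` on the nonnegative quadrant. [folklore] -/
theorem window_mono {B α₀ X αM XM : ℝ} (hB : 0 ≤ B) (hα : 0 ≤ α₀) (hX : 0 ≤ X) (hαM : α₀ ≤ αM) (hXM : X ≤ XM) :
    B * ((3 : ℝ) ^ 2 * (4 * ((2 : ℕ) : ℝ) * α₀ ^ 2 + (2 * X * Real.exp X + 4 * (X * Real.exp X) ^ 2) ^ 2))
      ≤ B * ((3 : ℝ) ^ 2 * (4 * ((2 : ℕ) : ℝ) * αM ^ 2 + (2 * XM * Real.exp XM + 4 * (XM * Real.exp XM) ^ 2) ^ 2)) := by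
  have h1 : α₀ ^ 2 ≤ αM ^ 2 := pow_le_pow_left₀ hα hαM 2
  have h2 : X * Real.exp X ≤ XM * Real.exp XM :=
    mul_le_mul hXM (Real.exp_le_exp.mpr hXM) (Real.exp_pos _).le (hX.trans hXM)
  have h20 : 0 ≤ X * Real.exp X := by positivity
  have h3 : (X * Real.exp X) ^ 2 ≤ (XM * Real.exp XM) ^ 2 := pow_le_pow_left₀ h20 h2 2
  have h4 : 2 * X * Real.exp X + 4 * (X * Real.exp X) ^ 2 ≤ 2 * XM * Real.exp XM + 4 * (XM * Real.exp XM) ^ 2 := by nlinarith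
  have h40 : 0 ≤ 2 * X * Real.exp X + 4 * (X * Real.exp X) ^ 2 := by positivity
  have h5 : (2 * X * Real.exp X + 4 * (X * Real.exp X) ^ 2) ^ 2 ≤ (2 * XM * Real.exp XM + 4 * (XM * Real.exp XM) ^ 2) ^ 2 := pow_le_pow_left₀ h40 h4 2
  have h6 : 4 * ((2 : ℕ) : ℝ) * α₀ ^ 2 + (2 * X * Real.exp X + 4 * (X * Real.exp X) ^ 2) ^ 2
      ≤ 4 * ((2 : ℕ) : ℝ) * αM ^ 2 + (2 * XM * Real.exp XM + 4 * (XM * Real.exp XM) ^ 2) ^ 2 := by nlinarith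
  exact mul_le_mul_of_nonneg_left (mul_le_mul_of_nonneg_left h6 (by positivity)) hB

/-- ★★ **THE MEMBER WINDOW ROW FROM AN L-ONLY INEQUALITY, UNIFORMLY IN THE LEVEL** — at the member `PV 2 ℓ m K hd3 hL` (block size `ℓ+1`, `k = K − n` levels) the window row of
✓ `linCorr_gauge_le_of_hKsup` ∕ ✓ `hLrow_of_hKsup_member` ∕ ✓ `hKsup_member` ∕ ✓ `linCorr_member` (VERBATIM) holds as soon as `0 ≤ α₀ ≤ α_M`, `c35·((ℓ+1)(ℓ+1)^{a′})·α₀ ≤ X_M` and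
`BIG·2²·(3²·(8α_M² + (2X_Me^{X_M} + 4(X_Me^{X_M})²)²)) ≤ 1∕4` (an inequality between L-only numbers). [cite: Balaban1985Variational, Prop. 7 p.299; Balaban1985RegularSpaces, (1.36) p.82] -/
theorem hwin_member_of_window {ℓ : ℕ} {hL : Odd (ℓ + 1) ∧ 1 < ℓ + 1} (m n K a' : ℕ) {α₀ c35 αM XM : ℝ} (hα₀ : 0 ≤ α₀) (hc35 : 0 ≤ c35) (hαM : α₀ ≤ αM)
    (hXM : c35 * (((ℓ + 1 : ℕ) : ℝ) * (((ℓ + 1) ^ a' : ℕ) : ℝ)) * α₀ ≤ XM)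
    (hW : (4 * 2197 * (24 * 289 * 24576 * 46116) : ℝ) * ((2 : ℕ) : ℝ) ^ 2 * ((3 : ℝ) ^ 2 * (4 * ((2 : ℕ) : ℝ) * αM ^ 2 + (2 * XM * Real.exp XM + 4 * (XM * Real.exp XM) ^ 2) ^ 2)) ≤ 1 / 4) :
        (4 * 2197 * (24 * 289 * 24576 * 46116) : ℝ) * ((2 : ℕ) : ℝ) ^ 2 * ((((PV 2 ℓ m K hd3 hL).L : ℝ)) ^ (K - n)) ^ 4
            * ((((PV 2 ℓ m K hd3 hL).d : ℝ)) ^ 2 * (4 * ((2 : ℕ) : ℝ) * (α₀ * ((((PV 2 ℓ m K hd3 hL).L : ℝ))⁻¹) ^ (2 * (K - n))) ^ 2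
              + (2 * ((((ℓ + 1 : ℕ) : ℝ) ^ (K - n))⁻¹ * ((((ℓ + 1 : ℕ) : ℝ) ^ (K - n))⁻¹ * (c35 * (((ℓ + 1 : ℕ) : ℝ) * (((ℓ + 1) ^ a' : ℕ) : ℝ)) * α₀))
                  * Real.exp ((((ℓ + 1 : ℕ) : ℝ) ^ (K - n))⁻¹ * (c35 * (((ℓ + 1 : ℕ) : ℝ) * (((ℓ + 1) ^ a' : ℕ) : ℝ)) * α₀)))
                + 4 * ((((ℓ + 1 : ℕ) : ℝ) ^ (K - n))⁻¹ * (c35 * (((ℓ + 1 : ℕ) : ℝ) * (((ℓ + 1) ^ a' : ℕ) : ℝ)) * α₀)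
                  * Real.exp ((((ℓ + 1 : ℕ) : ℝ) ^ (K - n))⁻¹ * (c35 * (((ℓ + 1 : ℕ) : ℝ) * (((ℓ + 1) ^ a' : ℕ) : ℝ)) * α₀))) ^ 2) ^ 2)) ≤ 1 / 4 := by
  have hLP : ((PV 2 ℓ m K hd3 hL).L : ℝ) = ((ℓ + 1 : ℕ) : ℝ) := rfl
  have hdP : ((PV 2 ℓ m K hd3 hL).d : ℝ) = 3 := by
    have : (PV 2 ℓ m K hd3 hL).d = 3 := rfl
    rw [this]; norm_num
  have hpow : ((((ℓ + 1 : ℕ) : ℝ))⁻¹) ^ (2 * (K - n)) = (((((ℓ + 1 : ℕ) : ℝ)) ^ (K - n))⁻¹) ^ 2 := by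
    rw [mul_comm, pow_mul, inv_pow, inv_pow]
  rw [hLP, hdP, hpow]
  have hℓk : (1 : ℝ) ≤ (((ℓ + 1 : ℕ) : ℝ)) ^ (K - n) := one_le_pow₀ (by exact_mod_cast Nat.succ_le_succ (Nat.zero_le ℓ))
  have hX0 : 0 ≤ c35 * (((ℓ + 1 : ℕ) : ℝ) * (((ℓ + 1) ^ a' : ℕ) : ℝ)) * α₀ := by positivity
  have hB : (0 : ℝ) ≤ (4 * 2197 * (24 * 289 * 24576 * 46116) : ℝ) * ((2 : ℕ) : ℝ) ^ 2 := by positivity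
  exact ((window_core hB hℓk hX0).trans (window_mono hB hα₀ hX0 hαM hXM)).trans hW

/-! ## §2 The (E1) conjunct at the members of record from `hThm2S` alone (plus L-only windows) -/

/-- ★★★ **THE (E1) CONJUNCT AT THE MEMBERS OF RECORD, BOTH SOCKETS DISCHARGED** — ✓ `pinnedSliceRow_member_of_thm2Datum` with `hDatumM := hDatum_of_thm2S_member` (px13 g4) and
`hLrowM := linCorr_member` (★routeR-w3 g6; its member window by `hwin_member_of_window`, `R := 2(ℓ+1)²`, `α₀ := e ≤ e₆ ≤ 1`): from the EX knit's [B8]-Theorem-2 binder at `L = ℓ+1`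
and L-only numeric windows ONLY.  Constants: `B₁' c₁' c35 a₅` (datum side), `c35L aL c C₂` (L-row side); `C := max (3∕2·(c√2)) (max (c√2) C₂)`; regime `((ℓ+1)(ℓ+1)^{a′})·e ≤ min a₅ aL`.
[cite: Balaban1985Variational, Prop. 7 p.299, (141)-(143) p.299, Prop. 2 p.281; Balaban1985RegularSpaces, Thm 2 p.83, (1.36) p.82, (1.72) p.88; Balaban1985BackgroundPropagators, (3.8) p.392, (3.35) p.396] -/
theorem pinnedSliceRow_member_of_thm2S_linCorr {ℓ : ℕ} (hℓ4 : 4 ≤ ℓ) (hL : Odd (ℓ + 1) ∧ 1 < ℓ + 1) {B₁ c₁ : ℝ} (hB₁ : 0 < B₁) (hc₁ : 0 < c₁)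
    (hThm2S : ∀ (F : T3Family), F.L = ℓ + 1 → ∀ (n K : ℕ), n < K →
      ∃ (β₀ B₂ : ℝ) (len : LSite (F.P K).d → ℝ), Thm2SetupSUAt (F.P K) 2 (K - n) (eta F n K) β₀ B₁ B₂ c₁ len (fun _ => True)) :
    ∃ B₁' c₁' c35 a₅ c35L aL c C₂ : ℝ, 0 < B₁' ∧ 0 < c₁' ∧ 0 < c35 ∧ 0 < a₅ ∧ 0 < c35L ∧ 0 < aL ∧ 0 < c ∧ 0 < C₂ ∧
    ∀ (e₆ s sQ : ℝ), 0 < e₆ → e₆ ≤ 1 → 2 * e₆ ≤ c₁' →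
      -- print's numeric windows at `e₆` (✓ `hDatum_of_thm2S_member`, VERBATIM)
      C0 3 * (2 * e₆) ≤ 1 / 3 → 8 * e₆ ≤ c2' 3 (ℓ + 1) →
      Real.exp (4 * (800 * ((3 : ℝ) + 1) ^ 2 * ((3 : ℝ) + 4)) * (2 * e₆)) * (1 + 8 * (131072 * ((3 : ℝ) + 1) ^ 2) * (2 * B₁' * e₆)) ≤ 2 →
      2 * (2 * B₁' * e₆) ≤ c3 3 (ℓ + 1) → 128 * (3 : ℝ) * (2 * B₁' * e₆) ≤ 1 →
      -- the door's windows at the member constants, `C := max (3∕2·(c√2)) (max (c√2) C₂)` (✓ `pinnedSliceRow_of_thm2Datum`)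
      (2 * B₁' * e₆) ≤ 1 / 64 → (240 * B₁' * e₆) ≤ 1 / 1024 → ((6 + 2 * (c35 * a₅ * Real.exp (c35 * a₅))) * (2 * (240 * B₁' * e₆))) ≤ 1 / 256 →
      ((2 * B₁' * e₆) + (1 + 2 * (2 * B₁' * e₆)) * ((1 + 6 * (240 * B₁' * e₆)) * ((6 + 2 * (c35 * a₅ * Real.exp (c35 * a₅))) * (2 * (240 * B₁' * e₆))))) ≤ s →
      ((6 * B₁' * e₆) + (3 : ℝ) * (((2 * ((c35 * a₅ * Real.exp (c35 * a₅)) + 2 * (c35 * a₅ * Real.exp (c35 * a₅)) ^ 2) + 24 * (c35 * a₅ * Real.exp (c35 * a₅)) + 24) * (2 * (240 * B₁' * e₆))) + 9 * ((6 + 2 * (c35 * a₅ * Real.exp (c35 * a₅))) * (2 * (240 * B₁' * e₆))) ^ 2 + 36 * (240 * B₁' * e₆) * ((2 * ((c35 * a₅ * Real.exp (c35 * a₅)) + 2 * (c35 * a₅ * Real.exp (c35 * a₅)) ^ 2) + 24 * (c35 * a₅ * Real.exp (c35 * a₅)) + 24) * (2 * (240 * B₁' * e₆)))) + (3 : ℝ)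 * (6 * ((6 + 2 * (c35 * a₅ * Real.exp (c35 * a₅))) * (2 * (240 * B₁' * e₆))) * (2 * B₁' * e₆) + 4 * (2 * B₁' * e₆) * ((1 + 6 * (240 * B₁' * e₆)) * ((6 + 2 * (c35 * a₅ * Real.exp (c35 * a₅))) * (2 * (240 * B₁' * e₆)))))) ≤ s →
      40 * s ≤ ((ℓ + 1 : ℕ) : ℝ) → 1800 * (max (3 / 2 * (c * Real.sqrt 2)) (max (c * Real.sqrt 2) C₂)) * s ≤ 1 → 3 / 2 * (max (3 / 2 * (c * Real.sqrt 2)) (max (c * Real.sqrt 2) C₂)) * (400 * (1 + 3)) * (7 * (3 / 2 * (max (3 / 2 * (c * Real.sqrt 2)) (max (c * Real.sqrt 2) C₂))) * s + s) ≤ 1 / 2 → sQ = 2 * s + 9 * (max (3 / 2 * (c * Real.sqrt 2)) (max (c * Real.sqrt 2) C₂)) * s →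
      -- the member window row, L-only form (§1) at `(α_M, X_M) := (e₆, c35L·aL)`
      (4 * 2197 * (24 * 289 * 24576 * 46116) : ℝ) * ((2 : ℕ) : ℝ) ^ 2 * ((3 : ℝ) ^ 2 * (4 * ((2 : ℕ) : ℝ) * e₆ ^ 2 + (2 * (c35L * aL) * Real.exp (c35L * aL) + 4 * ((c35L * aL) * Real.exp (c35L * aL)) ^ 2) ^ 2)) ≤ 1 / 4 →
    (∀ (F : T3Family), F.L = ℓ + 1 → ∀ (n K a' : ℕ) (hnK : n < K), a' + 3 ≤ F.m + n → 8 ≤ (ℓ + 1) ^ a' →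
    ∀ (e : ℝ) (V : GaugeField (F.P n) 0 (Matrix.specialUnitaryGroup (Fin 2) ℂ)) (W : GaugeField (F.P K) 0 (Matrix.specialUnitaryGroup (Fin 2) ℂ)),
      0 < e → e ≤ e₆ → ((ℓ + 1 : ℕ) : ℝ) * (((ℓ + 1) ^ a' : ℕ) : ℝ) * e ≤ min a₅ aL → W ∈ regFibrePr F n K hnK.le e V → IsCritR2 F n K hnK.le V W →
      ∀ W' : GaugeField (F.P K) 0 (Matrix.specialUnitaryGroup (Fin 2) ℂ), W' ∈ regFibrePr F n K hnK.le e V →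
        ∃ Y : GaugeField (F.P K) 0 (Matrix.specialUnitaryGroup (Fin 2) ℂ), Y ∈ regFibrePr F n K hnK.le e V ∧ wilsonAction4 W' = wilsonAction4 Y ∧
          (∀ b : PBond (F.P K) 0, ‖((Y b * (W b)⁻¹ : Matrix.specialUnitaryGroup (Fin 2) ℂ) : Matrix (Fin 2) (Fin 2) ℂ) - 1‖
            ≤ sQ * ((F.L : ℝ) ^ (K - n))⁻¹) ∧
          (∀ x : Site (F.P K) 0, x ∉ Set.range (embIter (K - n)) →
            divB (torusT (F.P K) 0) (fun κ z => unitsField (toUField W) ⟨z, κ⟩)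
              (fun μ z => covD (torusT (F.P K) 0) (fun κ z => unitsField (toUField W) ⟨z, κ⟩) μ
                (fun y => divB (torusT (F.P K) 0) (fun κ z => unitsField (toUField W) ⟨z, κ⟩)
                  (fun κ z => Complex.I • ((-Complex.I) • mlog ((Y ⟨z, κ⟩ * (W ⟨z, κ⟩)⁻¹ : Matrix.specialUnitaryGroup (Fin 2) ℂ) : Matrix (Fin 2) (Fin 2) ℂ))) y) z) x = 0)) := by
  obtain ⟨B₁', c₁', c35, a₅, hB₁', hc₁', hc35, ha₅, HP3⟩ := hDatum_of_thm2S_member hℓ4 hL hB₁ hc₁ hThm2S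
  obtain ⟨c35L, aL, c, C₂, hc35L, haL, hc, hC₂, HL⟩ := linCorr_member (hL := hL) hℓ4
  refine ⟨B₁', c₁', c35, a₅, c35L, aL, c, C₂, hB₁', hc₁', hc35, ha₅, hc35L, haL, hc, hC₂, ?_⟩
  intro e₆ s sQ he₆ he₆1 h2e₆ hw1 hw2 hw3 hw4 hw5 hs₀' hσ0 hσc hS₁ hS₂ hs40 hwin1 hwin2 hsQ hWL
  have hC : 0 ≤ max (3 / 2 * (c * Real.sqrt 2)) (max (c * Real.sqrt 2) C₂) := le_max_of_le_right (le_max_of_le_right hC₂.le)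
  refine pinnedSliceRow_member_of_thm2Datum (ℓ + 1) hC hs₀' hσ0 hσc hS₁ hS₂ hs40 hwin1 hwin2 hsQ ?_ ?_
  · -- (a) the datum socket at the members: px13 g4's P3, regime `min a₅ aL ≤ a₅`
    intro F hF n K a' hnK hsize hM8 e V W he hee hMα hW W' hW'
    exact HP3 e₆ he₆ h2e₆ hw1 hw2 hw3 hw4 hw5 F hF n K a' hnK hsize hM8 e V W he hee (hMα.trans (min_le_left _ _)) hW W' hW'
  · -- (b) the L-row socket at the members: ★routeR-w3's close, window by §1
    intro F hF n K a' hnK hsize hM8 e V W he hee hMα hW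
    obtain ⟨L', hL', m, hm⟩ := F
    change L' = ℓ + 1 at hF
    subst hF
    have hk1 : 1 ≤ K - n := by omega
    change a' + 3 ≤ m + n at hsize
    have hregW : RegPr (⟨ℓ + 1, hL', m, hm⟩ : T3Family) n K e W := ((mem_regFibrePr_iff (⟨ℓ + 1, hL', m, hm⟩ : T3Family)).1 hW).2
    have hMαL : ((ℓ + 1 : ℕ) : ℝ) * (((ℓ + 1) ^ a' : ℕ) : ℝ) * e ≤ aL := hMα.trans (min_le_right _ _)
    have hXM : c35L * (((ℓ + 1 : ℕ) : ℝ) * (((ℓ + 1) ^ a' : ℕ) : ℝ)) * e ≤ c35L * aL := by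
      have := mul_le_mul_of_nonneg_left hMαL hc35L.le
      simpa [mul_assoc] using this
    have hwin := hwin_member_of_window (hL := hL) m n K a' he.le hc35L.le hee hXM hWL
    exact HL hℓ4 m hm n K a' (2 * (ℓ + 1) ^ 2) hk1 hsize hM8 le_rfl e he (hee.trans he₆1) hMαL W hregW hwin

end Summit.QuantumFields.YangMills.Theorems.Prop7PinnedSliceRowMemberClosed

end
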